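/-
Public-audit package `pub-balaban` (b2b-balaban), surge lineage pv26, gen 14 (v1.1 docstring touch: gen 15).
Released under the Apache 2.0 licence, like Mathlib.
-/
import Literature.MathematicalPhysics.QuantumFieldTheory.Balaban1983to89.T4AxialGaugeSmallField
import Literature.MathematicalPhysics.QuantumFieldTheory.Balaban1983to89.T4ReTrLipUnitary

/-!
# T4 — the one-cube small-field sandwich: plaquette-small ⟹ some gauge copy lies in ONE exponential chart ⟹ plaquette-small
# (caveat (N1) of `T4CubeChartExp` closed at the configuration / indicator level; the gauge-orbit window event)

Kernel certificate, tags **[folklore]** throughout (0 `cite`): every statement below is PROVED here from Mathlib and from the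
already-landed leaves `T4AxialGaugeSmallField` (lineage pv26, gen 13: the torus box geometry `castSite` / `boxPlaqs` / `boxBonds`,
the axial gauge `axialGauge U lo hi` of a non-wrapping box and the INWARD direction «plaquette-small on the box ⟹ every box bond of
the axial-gauge copy lies in `expWindow 1 S`», `gaugeAct_axialGauge_mem_expWindow_of_mem_boxBonds` /
`expWindowDensity_one_gaugeAct_axialGauge`), `T4ExpWindowSmallField` (gen 12: the bond deviation bookkeeping `plaqDev` /
`dist1_plaqHol_le_add`, the window-versus-`dist1` comparison `dist1_inv_mul_le_of_mem_expWindow`, the product-window dictionary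
`expWindowDensity_eq_one_iff` / `_ne_zero_iff`, the indicator API `chiSmall_nonneg` / `_le_one` / `_eq_one` / `_eq_zero`),
`T4CubeChartExp` (gen 10: `expWindow`, `isCompact_expWindow`, `expWindowDensity`) and `T4ReTrLipUnitary` (unit b07: GAUGE
INVARIANCE of the plaquette small-field condition, `plaqSmallOn_gaugeAct_iff`, and `T4AvgDerivBound.gaugeAct_gaugeAct` through it),
all used BY NAME — nothing of them is re-proved or modified.  Nothing printed is asserted and nothing minted internally is cited
(ABSOLUTE RULE).  VALUE = a kernel-checked dictionary entry, NOT an estimate of the programme: the two one-sided comparisons of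
gen 12 (outward) and gen 13 (inward) are assembled into the consumer-facing TWO-SIDED statement on one cube, with the gauge
freedom made explicit as an event.

## What is proved

§1 GROUP LEVEL (any `[GaugeGroup G]`, torus carrier `Setup.GaugeField P j G`; interface axioms `dist1_mul_le` / `dist1_conj` /
`dist1_inv` / `dist1_one` only).
* `plaqBonds p` — the four boundary bonds of the plaquette `p`; `plaqBonds_subset_boxBonds`: the boundary bonds of a box
  plaquette (`p ∈ boxPlaqs lo hi`) are box bonds (`⊆ boxBonds lo hi`).
* THE LOCALIZED BOND → PLAQUETTE BOUND `plaqSmallOn_of_bdev_le_on`: if `dist1 (U₀(b)⁻¹ U(b)) ≤ τ` on a bond set `s` containing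
  the boundary bonds of every plaquette of `S₁`, then `PlaqSmallOn S₁ δ₀ U₀ → PlaqSmallOn S₁ (δ₀ + 4τ) U` (gen 12's
  `plaqSmallOn_of_bdev_le` asked the bond bound on EVERY bond of the torus); about the trivial configuration
  (`plaqHol_one`, `plaqSmallOn_one`): `dist1 (U b) ≤ τ` on `s` and `4τ < δ'` give `PlaqSmallOn S₁ δ' U` (`plaqSmallOn_of_dist1_le_on`).
* GAUGE INVARIANCE OF THE INDICATOR: `chiSmall S₁ δ (U^u) = chiSmall S₁ δ U` (`chiSmall_gaugeAct`, from b07's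
  `plaqSmallOn_gaugeAct_iff`), i.e. `GaugeField.GaugeInvariant (chiSmall S₁ δ)`.

§2 THE GAUGE-ORBIT WINDOW EVENT (`G = SU(2)`, the cell's `T4CubeChartGnomonic.SU2`).
* `GaugeWindowOn s S U := ∃ u : GaugeTransf P j SU2, ∀ b ∈ s, (U^u) b ∈ expWindow 1 S` — «SOME gauge copy of `U` has all its
  `s`-bonds in the ONE exponential chart of half-width `S` about `1`»; its `{0,1}`-valued indicator `chiGaugeWindow s S U`.
* Both are GAUGE INVARIANT (`gaugeWindowOn_gaugeAct_iff`, `chiGaugeWindow_gaugeAct`) and monotone in `s`.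
* The dictionary with gen 10's product window density about the trivial configuration: for a finite bond set `s`,
  `GaugeWindowOn ↑s S U ↔ ∃ u, expWindowDensity s 1 S (U^u) = 1` and `expWindowDensity s 1 S (U^u) ≤ chiGaugeWindow ↑s S U` for
  every gauge transformation `u`.
* MEASURABILITY: `{U | GaugeWindowOn s S U}` is CLOSED (the projection along the COMPACT factor `Site P j → SU2` of the closed set
  of pairs `(u, U)` with `u(b.src) U(b) u(b.tgt)⁻¹ ∈ expWindow 1 S` for `b ∈ s`, `isClosedMap_snd_of_compactSpace`), hence Borel
  measurable in the cell's product σ-algebra on `GaugeField P j SU2` (second countability of `SU(2)` BY NAME from the tree's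
  `QuantumLattice.secondCountableTopology_su2`), and `chiGaugeWindow s S` is measurable.

§3 THE SANDWICH.  For a NON-WRAPPING box `[lo, hi] ⊂ ℤ^d` of the torus (`hi ≤ lo + n`, `n < P.sitesPerDir j`):
* LOWER (inward; witness = the axial gauge of gen 13): `PlaqSmallOn S₀ δ U` with `S₀ ⊇ boxPlaqs lo hi`, `0 ≤ δ`, `0 ≤ S`,
  `(d − 1)·n·δ ≤ 2 sin(S/2)` ⟹ `GaugeWindowOn (boxBonds lo hi) S U`; hence `chiSmall S₀ δ U ≤ chiGaugeWindow (boxBonds lo hi) S U`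
  and `chiSmall S₀ δ U ≤ expWindowDensity s 1 S (U^{axialGauge})` for every finite `s ⊆ boxBonds lo hi`.
* UPPER (outward; NO box and no non-wrapping needed — any bond set `s` with `plaqBonds p ⊆ s` for `p ∈ S₁`):
  `GaugeWindowOn s S U` and `4·√3·S < δ'` ⟹ `PlaqSmallOn S₁ δ' U`; hence `chiGaugeWindow s S U ≤ chiSmall S₁ δ' U` and, for EVERY
  gauge transformation `u`, `expWindowDensity s 1 S (U^u) ≤ chiSmall S₁ δ' U` (gen 12's `expWindowDensity_le_chiSmall` without its
  hypothesis «`U = u₀` off `s`», for the plaquettes whose bonds lie in `s`).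
* TWO-SIDED on one cube (`S₀ = S₁ = boxPlaqs lo hi`, `s = boxBonds lo hi`):
  `chiSmall (boxPlaqs lo hi) δ U ≤ chiGaugeWindow (boxBonds lo hi) S U ≤ chiSmall (boxPlaqs lo hi) δ' U`
  (`chiSmall_sandwich`), the set-inclusion form `{PlaqSmallOn … δ} ⊆ {GaugeWindowOn …} ⊆ {PlaqSmallOn … δ'}`, and the
  LINEAR-RADIUS corollary with explicit constants: `S := (π/2)·(d − 1)·n·δ` and any `δ' > 2√3·π·(d − 1)·n·δ`
  (`chiSmall_sandwich_linear`; `2√3·π < 11`, so `δ' = 11·(d − 1)·n·δ` works whenever it is positive, `chiSmall_sandwich_eleven`);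
  NON-VACUITY: at `U = 1` all three indicators equal `1` (`sandwich_terms_at_one`).
  This is OUR PARAPHRASE — not a quotation: no such sentence is printed — of the programme's axial-gauge idea, with the loci as
  POINTERS ONLY: [Balaban1985Averaging] p. 24, (44)–(46) (printed there, verbatim: «let us introduce locally the axial gauge with
  the initial point y») and [Balaban1985RegularSpaces] p. 79, Lemma 1 with (1.24)–(1.25).  The paraphrase: after the axial gauge
  fixing ONE exponential chart about `1` covers the small-field configurations of a block, and conversely a block all of whose
  gauge-fixed bond variables lie in the chart is small-field with a worse constant.  (v1.1 = this paragraph reworded per the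
  cross-read certificate C-pv18g23-1 ∕ D1; docstring only, every declaration byte-identical to v1.)

## Caveats (honest scope)

* (NON-WRAPPING) The lower half needs the box NOT to wrap around the torus (`n < P.sitesPerDir j`): a wrapping box carries
  gauge-invariant non-contractible holonomies and has no axial gauge (gen 13's caveat, unchanged).  The upper half needs no box.
* (CORNER TREE / CONSTANT) The inward radius is gen 13's `(d − 1)·n·δ` (corner-based axial tree); a centred tree would halve it.
  Not optimised.
* (RADII) It is a SANDWICH, not an identity: between the inner threshold `δ` and the outer one `δ'` a factor
  `≈ 4√3·(d − 1)·n·S/(2 sin(S/2))` (`= 2√3·π·(d − 1)·n` in the linear form) is lost — the two plaquette small-field events differ,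
  and only the gauge-orbit window event sits between them.
* ((β3) UNTOUCHED) Everything is at the level of configurations and `{0,1}`-indicators.  The Faddeev–Popov / δ-function
  bookkeeping of INTEGRATING over the gauge orbit (fixing the axial gauge inside an integral, the induced measure on the slice) is
  not addressed here; `GaugeWindowOn` is an existential over the gauge group, not a gauge-fixed integral.
* (RANK) §2–§3 are for `SU(2)` only (the exponential window `expWindow` of this lineage is an `SU(2)` object); §1 is rank-free.
* (`<` VERSUS `≤`) `PlaqSmallOn` is strict (`<`), the window bounds are non-strict (`≤`); hence the strict `4·√3·S < δ'` in the
  upper half and the non-strict chord condition in the lower half, exactly as in gens 12–13.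
* (NO MEASURE THEORY beyond measurability) Nothing here concerns Haar measure, Jacobians or the renormalization densities.
-/

noncomputable section

open Set

namespace Literature.MathematicalPhysics.QuantumFieldTheory.Balaban1983to89.T4SmallFieldWindowSandwich

open B7Prop1Explicit (e)
open B8Lemma1NonAbelian (e_nonneg)
open GaugeField (plaqHol gaugeAct GaugeInvariant)
open T4TiltOscillation (bdev)
open T4ExpWindowSmallField (plaqDev dist1_plaqHol_le_add chiSmall_nonneg chiSmall_le_one chiSmall_eq_one chiSmall_eq_zero
  dist1_inv_mul_le_of_mem_expWindow expWindowDensity_eq_one_iff expWindowDensity_ne_zero_iff)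
open Literature.MathematicalPhysics.QuantumLattice (secondCountableTopology_su2)
open T4CubeChartGnomonic (SU2)
open T4CubeChartExp (expWindow expWindowDensity isCompact_expWindow expWindowDensity_nonneg expWindowDensity_le_one)
open T4AxialGaugeSmallField (castSite castSite_add_e boxPlaqs boxBonds axialGauge
  gaugeAct_axialGauge_mem_expWindow_of_mem_boxBonds gaugeAct_axialGauge_mem_expWindow_of_mem_boxBonds_linear
  expWindowDensity_one_gaugeAct_axialGauge)
open T4ReTrLipUnitary (plaqSmallOn_gaugeAct_iff)
open T4AvgDerivBound (gaugeAct_gaugeAct)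

/-! ## §1  Group level: boundary bonds of a plaquette, the localized bond → plaquette bound, gauge invariance of `chiSmall` -/

section GroupLevel

variable {P : Params} {j : ℕ} {G : Type*} [GaugeGroup G]

/-- THE FOUR BOUNDARY BONDS of the plaquette `p` at `x` in the `(μ, ν)` plane: `⟨x, μ⟩, ⟨x + e_μ, ν⟩, ⟨x + e_ν, μ⟩, ⟨x, ν⟩` — exactly
the bonds entering `Setup.GaugeField.plaqHol U p`. [folklore] -/
def plaqBonds (p : Plaq P j) : Set (PBond P j) :=
  {⟨p.src, p.μ⟩, ⟨p.src.shift p.μ, p.ν⟩, ⟨p.src.shift p.ν, p.μ⟩, ⟨p.src, p.ν⟩}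

/-- `⟨x, μ⟩ ∈ ∂p`. [folklore] -/
theorem mem_plaqBonds₁ (p : Plaq P j) : (⟨p.src, p.μ⟩ : PBond P j) ∈ plaqBonds p := by simp [plaqBonds]
/-- `⟨x + e_μ, ν⟩ ∈ ∂p`. [folklore] -/
theorem mem_plaqBonds₂ (p : Plaq P j) : (⟨p.src.shift p.μ, p.ν⟩ : PBond P j) ∈ plaqBonds p := by simp [plaqBonds]
/-- `⟨x + e_ν, μ⟩ ∈ ∂p`. [folklore] -/
theorem mem_plaqBonds₃ (p : Plaq P j) : (⟨p.src.shift p.ν, p.μ⟩ : PBond P j) ∈ plaqBonds p := by simp [plaqBonds]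
/-- `⟨x, ν⟩ ∈ ∂p`. [folklore] -/
theorem mem_plaqBonds₄ (p : Plaq P j) : (⟨p.src, p.ν⟩ : PBond P j) ∈ plaqBonds p := by simp [plaqBonds]

/-- LOCAL form of gen 12's `plaqDev_le_four_mul`: a bond-deviation bound on the four boundary bonds of `p` alone bounds the
plaquette deviation `plaqDev U U₀ p ≤ 4τ`. [folklore] -/
theorem plaqDev_le_four_mul_of_plaqBonds {U U₀ : GaugeField P j G} {τ : ℝ} {p : Plaq P j}
    (hb : ∀ b ∈ plaqBonds p, dist1 (bdev U U₀ b) ≤ τ) : plaqDev U U₀ p ≤ 4 * τ := by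
  have h₁ := hb _ (mem_plaqBonds₁ p)
  have h₂ := hb _ (mem_plaqBonds₂ p)
  have h₃ := hb _ (mem_plaqBonds₃ p)
  have h₄ := hb _ (mem_plaqBonds₄ p)
  unfold T4ExpWindowSmallField.plaqDev
  linarith

/-- `dist1 (U(∂p)) ≤ dist1 (U₀(∂p)) + 4τ` from the bond deviations on `∂p` only. [folklore] -/
theorem dist1_plaqHol_le_add_of_plaqBonds {U U₀ : GaugeField P j G} {τ : ℝ} {p : Plaq P j}
    (hb : ∀ b ∈ plaqBonds p, dist1 (bdev U U₀ b) ≤ τ) : dist1 (plaqHol U p) ≤ dist1 (plaqHol U₀ p) + 4 * τ :=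
  (dist1_plaqHol_le_add U U₀ p).trans (add_le_add le_rfl (plaqDev_le_four_mul_of_plaqBonds hb))

/-- **THE LOCALIZED BOND → PLAQUETTE BOUND**: a bond-deviation bound `dist1 (U₀(b)⁻¹ U(b)) ≤ τ` on a bond set `s` containing the
boundary of every plaquette of `S₁` turns `PlaqSmallOn S₁ δ₀ U₀` into `PlaqSmallOn S₁ (δ₀ + 4τ) U`. [folklore] -/
theorem plaqSmallOn_of_bdev_le_on {S₁ : Set (Plaq P j)} {s : Set (PBond P j)} {δ₀ τ : ℝ} {U U₀ : GaugeField P j G}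
    (hS₁ : ∀ p ∈ S₁, plaqBonds p ⊆ s) (h₀ : PlaqSmallOn S₁ δ₀ U₀) (hb : ∀ b ∈ s, dist1 (bdev U U₀ b) ≤ τ) :
    PlaqSmallOn S₁ (δ₀ + 4 * τ) U := fun p hp =>
  calc dist1 (plaqHol U p) ≤ dist1 (plaqHol U₀ p) + 4 * τ :=
        dist1_plaqHol_le_add_of_plaqBonds fun b hb' => hb b (hS₁ p hp hb')
    _ < δ₀ + 4 * τ := add_lt_add_of_lt_of_le (h₀ p hp) le_rfl

/-- The trivial configuration has trivial plaquette variables. [folklore] -/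
theorem plaqHol_one (p : Plaq P j) : plaqHol (1 : GaugeField P j G) p = 1 := by
  show (1 : G) * 1 * (1 : G)⁻¹ * (1 : G)⁻¹ = 1
  simp

/-- The trivial configuration is plaquette-small for every positive threshold. [folklore] -/
theorem plaqSmallOn_one (S₁ : Set (Plaq P j)) {δ : ℝ} (hδ : 0 < δ) : PlaqSmallOn S₁ δ (1 : GaugeField P j G) := fun p _ => by
  rw [plaqHol_one, GaugeGroup.dist1_one]
  exact hδ

/-- Hence its indicator is `1` (NON-VACUITY of the left end of the sandwich below). [folklore] -/
theorem chiSmall_one (S₁ : Set (Plaq P j)) {δ : ℝ} (hδ : 0 < δ) : chiSmall S₁ δ (1 : GaugeField P j G) = 1 :=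
  chiSmall_eq_one (plaqSmallOn_one S₁ hδ)

/-- The bond deviation from the trivial configuration is the bond variable itself. [folklore] -/
theorem bdev_one_right (U : GaugeField P j G) (b : PBond P j) : bdev U 1 b = U b := by
  show ((1 : G))⁻¹ * U b = U b
  rw [inv_one, one_mul]

/-- About the trivial configuration: `dist1 (U b) ≤ τ` on `s ⊇ ∂S₁` and `4τ < δ'` give `PlaqSmallOn S₁ δ' U`. [folklore] -/
theorem plaqSmallOn_of_dist1_le_on {S₁ : Set (Plaq P j)} {s : Set (PBond P j)} {τ δ' : ℝ} {U : GaugeField P j G}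
    (hS₁ : ∀ p ∈ S₁, plaqBonds p ⊆ s) (hb : ∀ b ∈ s, dist1 (U b) ≤ τ) (hδ' : 4 * τ < δ') : PlaqSmallOn S₁ δ' U := by
  have h := plaqSmallOn_of_bdev_le_on hS₁ (plaqSmallOn_one (G := G) S₁ (sub_pos.2 hδ'))
    (fun b hb' => by rw [bdev_one_right]; exact hb b hb')
  rwa [sub_add_cancel] at h

/-- **GAUGE INVARIANCE OF THE PLAQUETTE SMALL-FIELD INDICATOR**: `chiSmall S₁ δ (U^u) = chiSmall S₁ δ U` (from b07's
`T4ReTrLipUnitary.plaqSmallOn_gaugeAct_iff`). [folklore] -/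
theorem chiSmall_gaugeAct (S₁ : Set (Plaq P j)) (δ : ℝ) (u : GaugeTransf P j G) (U : GaugeField P j G) :
    chiSmall S₁ δ (gaugeAct u U) = chiSmall S₁ δ U := by
  by_cases h : PlaqSmallOn S₁ δ U
  · rw [chiSmall_eq_one h, chiSmall_eq_one ((plaqSmallOn_gaugeAct_iff S₁ δ u U).2 h)]
  · rw [chiSmall_eq_zero h, chiSmall_eq_zero (mt (plaqSmallOn_gaugeAct_iff S₁ δ u U).1 h)]

/-- `chiSmall S₁ δ` is a gauge-invariant function of the gauge field (`Setup.GaugeField.GaugeInvariant`). [folklore] -/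
theorem gaugeInvariant_chiSmall (S₁ : Set (Plaq P j)) (δ : ℝ) : GaugeInvariant (chiSmall S₁ δ : GaugeField P j G → ℝ) :=
  fun u U => chiSmall_gaugeAct S₁ δ u U

/-- The identity gauge transformation acts trivially. [folklore] -/
theorem gaugeAct_const_one (U : GaugeField P j G) : gaugeAct (fun _ => (1 : G)) U = U := by
  funext b
  simp [GaugeField.gaugeAct]

/-- BOX GEOMETRY: the four boundary bonds of a box plaquette are box bonds. [folklore] -/
theorem plaqBonds_subset_boxBonds {lo hi : Fin P.d → ℤ} {p : Plaq P j} (hp : p ∈ boxPlaqs (P := P) (j := j) lo hi) :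
    plaqBonds p ⊆ boxBonds lo hi := by
  obtain ⟨z, hlo, hhi, hsrc⟩ := hp
  have hμ0 : (0 : Fin P.d → ℤ) ≤ e p.μ := e_nonneg p.μ
  have hν0 : (0 : Fin P.d → ℤ) ≤ e p.ν := e_nonneg p.ν
  have hzμ : z ≤ z + e p.μ := le_add_of_nonneg_right hμ0
  have hzν : z ≤ z + e p.ν := le_add_of_nonneg_right hν0
  have hhi' : z + e p.ν + e p.μ ≤ hi := by rw [add_right_comm]; exact hhi
  intro b hb
  simp only [plaqBonds, Set.mem_insert_iff, Set.mem_singleton_iff] at hb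
  rcases hb with rfl | rfl | rfl | rfl
  · exact ⟨z, hlo, (le_add_of_nonneg_right hν0).trans hhi, hsrc⟩
  · exact ⟨z + e p.μ, hlo.trans hzμ, hhi, by rw [hsrc, castSite_add_e]⟩
  · exact ⟨z + e p.ν, hlo.trans hzν, hhi', by rw [hsrc, castSite_add_e]⟩
  · exact ⟨z, hlo, (le_add_of_nonneg_right hμ0).trans hhi', hsrc⟩

/-- Hence: every plaquette of the box has its boundary inside the box bonds (the shape of hypothesis `hS₁` below). [folklore] -/
theorem plaqBonds_subset_boxBonds_of_mem {lo hi : Fin P.d → ℤ} :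
    ∀ p ∈ boxPlaqs (P := P) (j := j) lo hi, plaqBonds p ⊆ boxBonds lo hi :=
  fun _ hp => plaqBonds_subset_boxBonds hp

end GroupLevel

/-! ## §2  The gauge-orbit window event on `SU(2)` -/

section OrbitWindow

variable {P : Params} {j : ℕ}

/-- **THE GAUGE-ORBIT WINDOW EVENT**: some gauge copy `U^u` of `U` has ALL its `s`-bond variables in the one exponential chart
`expWindow 1 S` of half-width `S` about the identity. [folklore] -/
def GaugeWindowOn (s : Set (PBond P j)) (S : ℝ) (U : GaugeField P j SU2) : Prop :=
  ∃ u : GaugeTransf P j SU2, ∀ b ∈ s, gaugeAct u U b ∈ expWindow 1 S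

open Classical in
/-- Its `{0,1}`-valued indicator. [folklore] -/
def chiGaugeWindow (s : Set (PBond P j)) (S : ℝ) (U : GaugeField P j SU2) : ℝ :=
  if GaugeWindowOn s S U then 1 else 0

/-- In the event the indicator is `1`. [folklore] -/
theorem chiGaugeWindow_eq_one {s : Set (PBond P j)} {S : ℝ} {U : GaugeField P j SU2} (h : GaugeWindowOn s S U) :
    chiGaugeWindow s S U = 1 := by
  simp [chiGaugeWindow, h]

/-- Outside the event the indicator is `0`. [folklore] -/
theorem chiGaugeWindow_eq_zero {s : Set (PBond P j)} {S : ℝ} {U : GaugeField P j SU2} (h : ¬ GaugeWindowOn s S U) :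
    chiGaugeWindow s S U = 0 := by
  simp [chiGaugeWindow, h]

/-- `0 ≤ chiGaugeWindow s S U`. [folklore] -/
theorem chiGaugeWindow_nonneg (s : Set (PBond P j)) (S : ℝ) (U : GaugeField P j SU2) : 0 ≤ chiGaugeWindow s S U := by
  by_cases h : GaugeWindowOn s S U
  · rw [chiGaugeWindow_eq_one h]; exact zero_le_one
  · rw [chiGaugeWindow_eq_zero h]

/-- `chiGaugeWindow s S U ≤ 1`. [folklore] -/
theorem chiGaugeWindow_le_one (s : Set (PBond P j)) (S : ℝ) (U : GaugeField P j SU2) : chiGaugeWindow s S U ≤ 1 := by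
  by_cases h : GaugeWindowOn s S U
  · rw [chiGaugeWindow_eq_one h]
  · rw [chiGaugeWindow_eq_zero h]; exact zero_le_one

/-- Monotonicity in the bond set: fewer bonds, weaker event. [folklore] -/
theorem GaugeWindowOn.mono {s t : Set (PBond P j)} {S : ℝ} {U : GaugeField P j SU2} (h : GaugeWindowOn s S U) (hts : t ⊆ s) :
    GaugeWindowOn t S U := by
  obtain ⟨u, hu⟩ := h
  exact ⟨u, fun b hb => hu b (hts hb)⟩

/-- The indicator is antitone in the bond set. [folklore] -/
theorem chiGaugeWindow_mono {s t : Set (PBond P j)} (hts : t ⊆ s) (S : ℝ) (U : GaugeField P j SU2) :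
    chiGaugeWindow s S U ≤ chiGaugeWindow t S U := by
  by_cases h : GaugeWindowOn s S U
  · rw [chiGaugeWindow_eq_one h, chiGaugeWindow_eq_one (h.mono hts)]
  · rw [chiGaugeWindow_eq_zero h]; exact chiGaugeWindow_nonneg _ _ _

/-- The trivial configuration is in the event for every `S ≥ 0` (witness `u = 1`). [folklore] -/
theorem gaugeWindowOn_one (s : Set (PBond P j)) {S : ℝ} (hS : 0 ≤ S) : GaugeWindowOn s S (1 : GaugeField P j SU2) :=
  ⟨fun _ => 1, fun b _ => by
    rw [gaugeAct_const_one]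
    exact T4CubeChartExp.mem_expWindow_self hS⟩

/-- Hence its indicator is `1` there (NON-VACUITY of the middle term of the sandwich below). [folklore] -/
theorem chiGaugeWindow_one (s : Set (PBond P j)) {S : ℝ} (hS : 0 ≤ S) : chiGaugeWindow s S (1 : GaugeField P j SU2) = 1 :=
  chiGaugeWindow_eq_one (gaugeWindowOn_one s hS)

/-- **GAUGE INVARIANCE OF THE EVENT**: `GaugeWindowOn s S (U^v) ↔ GaugeWindowOn s S U`. [folklore] -/
theorem gaugeWindowOn_gaugeAct_iff (s : Set (PBond P j)) (S : ℝ) (v : GaugeTransf P j SU2) (U : GaugeField P j SU2) :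
    GaugeWindowOn s S (gaugeAct v U) ↔ GaugeWindowOn s S U := by
  constructor
  · rintro ⟨u, hu⟩
    exact ⟨fun y => u y * v y, fun b hb => by rw [← gaugeAct_gaugeAct]; exact hu b hb⟩
  · rintro ⟨u, hu⟩
    refine ⟨fun y => u y * (v y)⁻¹, fun b hb => ?_⟩
    have huv : (fun y => u y * (v y)⁻¹ * v y) = u := funext fun y => inv_mul_cancel_right (u y) (v y)
    rw [gaugeAct_gaugeAct, huv]
    exact hu b hb

/-- … and of its indicator. [folklore] -/
theorem chiGaugeWindow_gaugeAct (s : Set (PBond P j)) (S : ℝ) (v : GaugeTransf P j SU2) (U : GaugeField P j SU2) :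
    chiGaugeWindow s S (gaugeAct v U) = chiGaugeWindow s S U := by
  by_cases h : GaugeWindowOn s S U
  · rw [chiGaugeWindow_eq_one h, chiGaugeWindow_eq_one ((gaugeWindowOn_gaugeAct_iff s S v U).2 h)]
  · rw [chiGaugeWindow_eq_zero h, chiGaugeWindow_eq_zero (mt (gaugeWindowOn_gaugeAct_iff s S v U).1 h)]

/-- `chiGaugeWindow s S` is a gauge-invariant function of the gauge field (`Setup.GaugeField.GaugeInvariant`). [folklore] -/
theorem gaugeInvariant_chiGaugeWindow (s : Set (PBond P j)) (S : ℝ) : GaugeInvariant (chiGaugeWindow s S) :=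
  fun v U => chiGaugeWindow_gaugeAct s S v U

/-- DICTIONARY WITH THE PRODUCT WINDOW DENSITY (gen 10's `expWindowDensity` about the trivial configuration `1`): on a finite bond
set, the event holds iff some gauge copy has window density `1`. [folklore] -/
theorem gaugeWindowOn_iff_exists_expWindowDensity_eq_one {s : Finset (PBond P j)} {S : ℝ} {U : GaugeField P j SU2} :
    GaugeWindowOn ↑s S U ↔ ∃ u : GaugeTransf P j SU2, expWindowDensity s 1 S (gaugeAct u U) = 1 := by
  refine exists_congr fun u => ?_
  rw [expWindowDensity_eq_one_iff]
  exact Iff.rfl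

/-- The window density of ANY gauge copy is dominated by the indicator of the event. [folklore] -/
theorem expWindowDensity_gaugeAct_le_chiGaugeWindow {s : Finset (PBond P j)} {S : ℝ} (u : GaugeTransf P j SU2)
    (U : GaugeField P j SU2) : expWindowDensity s 1 S (gaugeAct u U) ≤ chiGaugeWindow ↑s S U := by
  by_cases h : expWindowDensity s 1 S (gaugeAct u U) = 0
  · rw [h]; exact chiGaugeWindow_nonneg _ _ _
  · have hmem := expWindowDensity_ne_zero_iff.1 h
    rw [chiGaugeWindow_eq_one ⟨u, fun b hb => hmem b hb⟩]
    exact expWindowDensity_le_one _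

/-- In particular (`u = 1`) the window density about `1` itself is dominated by the indicator of the event. [folklore] -/
theorem expWindowDensity_le_chiGaugeWindow {s : Finset (PBond P j)} {S : ℝ} (U : GaugeField P j SU2) :
    expWindowDensity s 1 S U ≤ chiGaugeWindow ↑s S U := by
  have h := expWindowDensity_gaugeAct_le_chiGaugeWindow (s := s) (S := S) (fun _ => (1 : SU2)) U
  rwa [gaugeAct_const_one] at h

/-! ### §2b  Measurability of the event (closed, by compactness of the gauge group) -/

/-- The set of pairs `(u, U)` (gauge transformation, configuration) with `u(b.src) U(b) u(b.tgt)⁻¹ ∈ expWindow 1 S` for all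
`b ∈ s` is CLOSED (finite intersection of preimages of the compact window under continuous maps). [folklore] -/
theorem isClosed_windowPairs (s : Set (PBond P j)) (S : ℝ) :
    IsClosed {q : (Site P j → SU2) × (PBond P j → SU2) | ∀ b ∈ s, q.1 b.src * q.2 b * (q.1 b.tgt)⁻¹ ∈ expWindow 1 S} := by
  have hrepr : {q : (Site P j → SU2) × (PBond P j → SU2) | ∀ b ∈ s, q.1 b.src * q.2 b * (q.1 b.tgt)⁻¹ ∈ expWindow 1 S} =
      ⋂ b ∈ s, (fun q : (Site P j → SU2) × (PBond P j → SU2) => q.1 b.src * q.2 b * (q.1 b.tgt)⁻¹) ⁻¹' expWindow 1 S := by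
    ext q
    simp only [Set.mem_setOf_eq, Set.mem_iInter, Set.mem_preimage]
  rw [hrepr]
  refine isClosed_biInter fun b _ => (isCompact_expWindow (g := (1 : SU2)) (S := S)).isClosed.preimage ?_
  exact (((continuous_apply b.src).comp continuous_fst).mul ((continuous_apply b).comp continuous_snd)).mul
    (((continuous_apply b.tgt).comp continuous_fst).inv)

/-- **THE EVENT IS CLOSED** in `PBond P j → SU2`: it is the projection of the closed set of pairs along the COMPACT factor
`Site P j → SU2` (`isClosedMap_snd_of_compactSpace`). [folklore] -/
theorem isClosed_gaugeWindowOn (s : Set (PBond P j)) (S : ℝ) : IsClosed {U : PBond P j → SU2 | GaugeWindowOn s S U} := by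
  have h := isClosedMap_snd_of_compactSpace (X := Site P j → SU2) (Y := PBond P j → SU2) _ (isClosed_windowPairs s S)
  have hrepr : {U : PBond P j → SU2 | GaugeWindowOn s S U} =
      Prod.snd '' {q : (Site P j → SU2) × (PBond P j → SU2) | ∀ b ∈ s, q.1 b.src * q.2 b * (q.1 b.tgt)⁻¹ ∈ expWindow 1 S} := by
    ext U
    simp only [Set.mem_setOf_eq, Set.mem_image, Prod.exists, exists_eq_right]
    exact Iff.rfl
  rw [hrepr]
  exact h

/-- **MEASURABILITY**: the event is a Borel = product-measurable set of the cell's measurable space `GaugeField P j SU2`. [folklore] -/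
theorem measurableSet_gaugeWindowOn (s : Set (PBond P j)) (S : ℝ) :
    MeasurableSet {U : GaugeField P j SU2 | GaugeWindowOn s S U} := by
  haveI : SecondCountableTopology SU2 := secondCountableTopology_su2
  exact (isClosed_gaugeWindowOn s S).measurableSet

/-- The indicator `chiGaugeWindow s S` is measurable. [folklore] -/
theorem measurable_chiGaugeWindow (s : Set (PBond P j)) (S : ℝ) : Measurable (chiGaugeWindow (P := P) (j := j) s S) := by
  unfold chiGaugeWindow
  exact Measurable.ite (measurableSet_gaugeWindowOn s S) measurable_const measurable_const

end OrbitWindow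

/-! ## §3  The sandwich -/

section Sandwich

variable {P : Params} {j : ℕ}

/-- **LOWER HALF (inward)**: plaquette-small on (a superset of) the plaquettes of a NON-WRAPPING box, with the chord radius
condition `(d − 1)·n·δ ≤ 2 sin(S/2)`, puts `U` in the gauge-orbit window event of the box bonds — witness: gen 13's axial gauge.
[folklore] -/
theorem gaugeWindowOn_boxBonds_of_plaqSmallOn (U : GaugeField P j SU2) {lo hi : Fin P.d → ℤ} {δ S : ℝ} {S₀ : Set (Plaq P j)}
    {n : ℕ} (hS₀ : boxPlaqs lo hi ⊆ S₀) (hU : PlaqSmallOn S₀ δ U) (hδ : 0 ≤ δ) (hn : ∀ κ, hi κ ≤ lo κ + n)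
    (hnN : n < P.sitesPerDir j) (hS : 0 ≤ S) (hrad : ((P.d - 1 : ℕ) : ℝ) * n * δ ≤ 2 * Real.sin (S / 2)) :
    GaugeWindowOn (boxBonds lo hi) S U :=
  ⟨axialGauge U lo hi, fun _ hb => gaugeAct_axialGauge_mem_expWindow_of_mem_boxBonds U hS₀ hU hδ hn hnN hS hrad hb⟩

/-- Lower half, linear radius `(d − 1)·n·δ ≤ 2S/π`. [folklore] -/
theorem gaugeWindowOn_boxBonds_of_plaqSmallOn_linear (U : GaugeField P j SU2) {lo hi : Fin P.d → ℤ} {δ S : ℝ}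
    {S₀ : Set (Plaq P j)} {n : ℕ} (hS₀ : boxPlaqs lo hi ⊆ S₀) (hU : PlaqSmallOn S₀ δ U) (hδ : 0 ≤ δ)
    (hn : ∀ κ, hi κ ≤ lo κ + n) (hnN : n < P.sitesPerDir j) (hS : 0 ≤ S)
    (hrad : ((P.d - 1 : ℕ) : ℝ) * n * δ ≤ 2 * S / Real.pi) : GaugeWindowOn (boxBonds lo hi) S U :=
  ⟨axialGauge U lo hi, fun _ hb => gaugeAct_axialGauge_mem_expWindow_of_mem_boxBonds_linear U hS₀ hU hδ hn hnN hS hrad hb⟩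

/-- Lower half, indicator form: `chiSmall S₀ δ U ≤ chiGaugeWindow (boxBonds lo hi) S U`. [folklore] -/
theorem chiSmall_le_chiGaugeWindow (U : GaugeField P j SU2) {lo hi : Fin P.d → ℤ} {δ S : ℝ} {S₀ : Set (Plaq P j)} {n : ℕ}
    (hS₀ : boxPlaqs lo hi ⊆ S₀) (hδ : 0 ≤ δ) (hn : ∀ κ, hi κ ≤ lo κ + n) (hnN : n < P.sitesPerDir j) (hS : 0 ≤ S)
    (hrad : ((P.d - 1 : ℕ) : ℝ) * n * δ ≤ 2 * Real.sin (S / 2)) :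
    chiSmall S₀ δ U ≤ chiGaugeWindow (boxBonds lo hi) S U := by
  by_cases hU : PlaqSmallOn S₀ δ U
  · rw [chiSmall_eq_one hU, chiGaugeWindow_eq_one (gaugeWindowOn_boxBonds_of_plaqSmallOn U hS₀ hU hδ hn hnN hS hrad)]
  · rw [chiSmall_eq_zero hU]; exact chiGaugeWindow_nonneg _ _ _

/-- Lower half, density form: `chiSmall S₀ δ U ≤ expWindowDensity s 1 S (U^{axialGauge})` for every finite `s ⊆ boxBonds`. [folklore] -/
theorem chiSmall_le_expWindowDensity_axialGauge (U : GaugeField P j SU2) {lo hi : Fin P.d → ℤ} {δ S : ℝ}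
    {S₀ : Set (Plaq P j)} {n : ℕ} (hS₀ : boxPlaqs lo hi ⊆ S₀) (hδ : 0 ≤ δ) (hn : ∀ κ, hi κ ≤ lo κ + n)
    (hnN : n < P.sitesPerDir j) (hS : 0 ≤ S) (hrad : ((P.d - 1 : ℕ) : ℝ) * n * δ ≤ 2 * Real.sin (S / 2))
    {s : Finset (PBond P j)} (hs : ∀ b ∈ s, b ∈ boxBonds lo hi) :
    chiSmall S₀ δ U ≤ expWindowDensity s 1 S (gaugeAct (axialGauge U lo hi) U) := by
  by_cases hU : PlaqSmallOn S₀ δ U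
  · rw [chiSmall_eq_one hU, expWindowDensity_one_gaugeAct_axialGauge U hS₀ hU hδ hn hnN hS hrad hs]
  · rw [chiSmall_eq_zero hU]; exact expWindowDensity_nonneg _

/-- **UPPER HALF (outward)**: the gauge-orbit window event on a bond set `s` containing the boundary of every plaquette of `S₁`
forces `PlaqSmallOn S₁ δ' U` for every `δ' > 4·√3·S` (per bond `dist1 ≤ √3·S` in the window, four bonds per plaquette, then
gauge invariance).  No box, no non-wrapping hypothesis. [folklore] -/
theorem plaqSmallOn_of_gaugeWindowOn {s : Set (PBond P j)} {S : ℝ} {U : GaugeField P j SU2} (h : GaugeWindowOn s S U)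
    {S₁ : Set (Plaq P j)} (hS₁ : ∀ p ∈ S₁, plaqBonds p ⊆ s) {δ' : ℝ} (hδ' : 4 * (Real.sqrt 3 * S) < δ') :
    PlaqSmallOn S₁ δ' U := by
  obtain ⟨u, hu⟩ := h
  have h1 : PlaqSmallOn S₁ δ' (gaugeAct u U) :=
    plaqSmallOn_of_dist1_le_on hS₁ (fun b hb => by
      have hb' := dist1_inv_mul_le_of_mem_expWindow (hu b hb)
      rwa [inv_one, one_mul] at hb') hδ'
  exact (plaqSmallOn_gaugeAct_iff S₁ δ' u U).1 h1

/-- Upper half, indicator form: `chiGaugeWindow s S U ≤ chiSmall S₁ δ' U`. [folklore] -/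
theorem chiGaugeWindow_le_chiSmall {s : Set (PBond P j)} {S : ℝ} {S₁ : Set (Plaq P j)} (hS₁ : ∀ p ∈ S₁, plaqBonds p ⊆ s)
    {δ' : ℝ} (hδ' : 4 * (Real.sqrt 3 * S) < δ') (U : GaugeField P j SU2) : chiGaugeWindow s S U ≤ chiSmall S₁ δ' U := by
  by_cases h : GaugeWindowOn s S U
  · rw [chiGaugeWindow_eq_one h, chiSmall_eq_one (plaqSmallOn_of_gaugeWindowOn h hS₁ hδ')]
  · rw [chiGaugeWindow_eq_zero h]; exact chiSmall_nonneg _ _ _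

/-- Upper half, density form, EVERY GAUGE: `expWindowDensity s 1 S (U^u) ≤ chiSmall S₁ δ' U` — gen 12's
`expWindowDensity_le_chiSmall` freed of its hypothesis «`U = u₀` off `s`», for the plaquettes bounded by `s`. [folklore] -/
theorem expWindowDensity_gaugeAct_le_chiSmall {s : Finset (PBond P j)} {S : ℝ} {S₁ : Set (Plaq P j)}
    (hS₁ : ∀ p ∈ S₁, plaqBonds p ⊆ ↑s) {δ' : ℝ} (hδ' : 4 * (Real.sqrt 3 * S) < δ') (u : GaugeTransf P j SU2)
    (U : GaugeField P j SU2) : expWindowDensity s 1 S (gaugeAct u U) ≤ chiSmall S₁ δ' U :=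
  (expWindowDensity_gaugeAct_le_chiGaugeWindow u U).trans (chiGaugeWindow_le_chiSmall hS₁ hδ' U)

/-- … in particular for `u = 1`: `expWindowDensity s 1 S U ≤ chiSmall S₁ δ' U`. [folklore] -/
theorem expWindowDensity_le_chiSmall_on {s : Finset (PBond P j)} {S : ℝ} {S₁ : Set (Plaq P j)}
    (hS₁ : ∀ p ∈ S₁, plaqBonds p ⊆ ↑s) {δ' : ℝ} (hδ' : 4 * (Real.sqrt 3 * S) < δ') (U : GaugeField P j SU2) :
    expWindowDensity s 1 S U ≤ chiSmall S₁ δ' U :=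
  (expWindowDensity_le_chiGaugeWindow U).trans (chiGaugeWindow_le_chiSmall hS₁ hδ' U)

/-- **THE ONE-CUBE SANDWICH** (chord radius): for a non-wrapping box, `0 ≤ δ`, `0 ≤ S`, `(d − 1)·n·δ ≤ 2 sin(S/2)` and
`4·√3·S < δ'`,
`chiSmall (boxPlaqs lo hi) δ U ≤ chiGaugeWindow (boxBonds lo hi) S U ≤ chiSmall (boxPlaqs lo hi) δ' U`. [folklore] -/
theorem chiSmall_sandwich (U : GaugeField P j SU2) {lo hi : Fin P.d → ℤ} {δ δ' S : ℝ} {n : ℕ} (hδ : 0 ≤ δ)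
    (hn : ∀ κ, hi κ ≤ lo κ + n) (hnN : n < P.sitesPerDir j) (hS : 0 ≤ S)
    (hrad : ((P.d - 1 : ℕ) : ℝ) * n * δ ≤ 2 * Real.sin (S / 2)) (hδ' : 4 * (Real.sqrt 3 * S) < δ') :
    chiSmall (boxPlaqs lo hi) δ U ≤ chiGaugeWindow (boxBonds lo hi) S U ∧
      chiGaugeWindow (boxBonds lo hi) S U ≤ chiSmall (boxPlaqs lo hi) δ' U :=
  ⟨chiSmall_le_chiGaugeWindow U subset_rfl hδ hn hnN hS hrad,
    chiGaugeWindow_le_chiSmall plaqBonds_subset_boxBonds_of_mem hδ' U⟩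

/-- NON-VACUITY: at the trivial configuration all three terms of the sandwich equal `1` (`0 < δ`, `0 ≤ S`, `0 < δ'`), so
neither inequality is an artefact of an empty event. [folklore] -/
theorem sandwich_terms_at_one (lo hi : Fin P.d → ℤ) {δ δ' S : ℝ} (hδ : 0 < δ) (hS : 0 ≤ S) (hδ' : 0 < δ') :
    chiSmall (boxPlaqs lo hi) δ (1 : GaugeField P j SU2) = 1 ∧
      chiGaugeWindow (boxBonds (P := P) (j := j) lo hi) S 1 = 1 ∧
        chiSmall (boxPlaqs lo hi) δ' (1 : GaugeField P j SU2) = 1 :=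
  ⟨chiSmall_one _ hδ, chiGaugeWindow_one _ hS, chiSmall_one _ hδ'⟩

/-- Set form of the lower half: `{PlaqSmallOn (boxPlaqs) δ} ⊆ {GaugeWindowOn (boxBonds) S}`. [folklore] -/
theorem setOf_plaqSmallOn_subset_setOf_gaugeWindowOn {lo hi : Fin P.d → ℤ} {δ S : ℝ} {n : ℕ} (hδ : 0 ≤ δ)
    (hn : ∀ κ, hi κ ≤ lo κ + n) (hnN : n < P.sitesPerDir j) (hS : 0 ≤ S)
    (hrad : ((P.d - 1 : ℕ) : ℝ) * n * δ ≤ 2 * Real.sin (S / 2)) :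
    {U : GaugeField P j SU2 | PlaqSmallOn (boxPlaqs lo hi) δ U} ⊆ {U | GaugeWindowOn (boxBonds lo hi) S U} :=
  fun U hU => gaugeWindowOn_boxBonds_of_plaqSmallOn U subset_rfl hU hδ hn hnN hS hrad

/-- Set form of the upper half: `{GaugeWindowOn (boxBonds) S} ⊆ {PlaqSmallOn (boxPlaqs) δ'}`. [folklore] -/
theorem setOf_gaugeWindowOn_subset_setOf_plaqSmallOn {lo hi : Fin P.d → ℤ} {S δ' : ℝ} (hδ' : 4 * (Real.sqrt 3 * S) < δ') :
    {U : GaugeField P j SU2 | GaugeWindowOn (boxBonds lo hi) S U} ⊆ {U | PlaqSmallOn (boxPlaqs lo hi) δ' U} :=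
  fun _ hU => plaqSmallOn_of_gaugeWindowOn hU plaqBonds_subset_boxBonds_of_mem hδ'

/-- **THE ONE-CUBE SANDWICH, linear radius with explicit constants**: with `S := (π/2)·((d − 1)·n·δ)` (so that
`(d − 1)·n·δ = 2S/π`) and any `δ' > 2√3·π·((d − 1)·n·δ)` (`= 4√3·S`). [folklore] -/
theorem chiSmall_sandwich_linear (U : GaugeField P j SU2) {lo hi : Fin P.d → ℤ} {δ δ' : ℝ} {n : ℕ} (hδ : 0 ≤ δ)
    (hn : ∀ κ, hi κ ≤ lo κ + n) (hnN : n < P.sitesPerDir j)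
    (hδ' : 2 * Real.sqrt 3 * Real.pi * (((P.d - 1 : ℕ) : ℝ) * n * δ) < δ') :
    chiSmall (boxPlaqs lo hi) δ U ≤ chiGaugeWindow (boxBonds lo hi) (Real.pi / 2 * (((P.d - 1 : ℕ) : ℝ) * n * δ)) U ∧
      chiGaugeWindow (boxBonds lo hi) (Real.pi / 2 * (((P.d - 1 : ℕ) : ℝ) * n * δ)) U ≤ chiSmall (boxPlaqs lo hi) δ' U := by
  set a : ℝ := ((P.d - 1 : ℕ) : ℝ) * n * δ with ha
  have ha0 : 0 ≤ a := by rw [ha]; positivity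
  have hS : 0 ≤ Real.pi / 2 * a := by positivity
  have hrad : a ≤ 2 * (Real.pi / 2 * a) / Real.pi := by
    rw [show 2 * (Real.pi / 2 * a) / Real.pi = a by field_simp]
  have hδ'' : 4 * (Real.sqrt 3 * (Real.pi / 2 * a)) < δ' := by
    calc 4 * (Real.sqrt 3 * (Real.pi / 2 * a)) = 2 * Real.sqrt 3 * Real.pi * a := by ring
      _ < δ' := hδ'
  refine ⟨?_, chiGaugeWindow_le_chiSmall plaqBonds_subset_boxBonds_of_mem hδ'' U⟩
  by_cases hU : PlaqSmallOn (boxPlaqs lo hi) δ U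
  · rw [chiSmall_eq_one hU,
      chiGaugeWindow_eq_one (gaugeWindowOn_boxBonds_of_plaqSmallOn_linear U subset_rfl hU hδ hn hnN hS hrad)]
  · rw [chiSmall_eq_zero hU]; exact chiGaugeWindow_nonneg _ _ _

/-- The numerical constant: `2·√3·π < 11` (`2√3π ≈ 10.88`). [folklore] -/
theorem two_mul_sqrt_three_mul_pi_lt_eleven : 2 * Real.sqrt 3 * Real.pi < 11 := by
  have h3 : Real.sqrt 3 < 1.7321 := by
    rw [Real.sqrt_lt' (by norm_num)]
    norm_num
  have hπ : Real.pi < 3.15 := Real.pi_lt_d2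
  have h0 : 0 < Real.sqrt 3 := Real.sqrt_pos.2 (by norm_num)
  nlinarith [Real.pi_pos]

/-- **THE ONE-CUBE SANDWICH with the round constant `11`**: `S := (π/2)·((d − 1)·n·δ)`, `δ' := 11·((d − 1)·n·δ)`, for
`(d − 1)·n·δ > 0`. [folklore] -/
theorem chiSmall_sandwich_eleven (U : GaugeField P j SU2) {lo hi : Fin P.d → ℤ} {δ : ℝ} {n : ℕ} (hδ : 0 ≤ δ)
    (hn : ∀ κ, hi κ ≤ lo κ + n) (hnN : n < P.sitesPerDir j) (hpos : 0 < ((P.d - 1 : ℕ) : ℝ) * n * δ) :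
    chiSmall (boxPlaqs lo hi) δ U ≤ chiGaugeWindow (boxBonds lo hi) (Real.pi / 2 * (((P.d - 1 : ℕ) : ℝ) * n * δ)) U ∧
      chiGaugeWindow (boxBonds lo hi) (Real.pi / 2 * (((P.d - 1 : ℕ) : ℝ) * n * δ)) U ≤
        chiSmall (boxPlaqs lo hi) (11 * (((P.d - 1 : ℕ) : ℝ) * n * δ)) U :=
  chiSmall_sandwich_linear U hδ hn hnN
    (mul_lt_mul_of_pos_right two_mul_sqrt_three_mul_pi_lt_eleven hpos)

end Sandwich

end Literature.MathematicalPhysics.QuantumFieldTheory.Balaban1983to89.T4SmallFieldWindowSandwich
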